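import Summits.NavierStokesRegularity.NavierStokesRegularity.Theorems.RungBlowupCofinal.PureWaveExclusion
import Literature.Analysis.FluidPDE.LambFormCurlKernel
import HarnessLib

/-!
# THE BAND PART OF THE LAMB VECTOR IS LOAD-BEARING for precessing rung profiles: a Type-I
# precessing (or steady) rung profile whose self-advection — equivalently whose Lamb vector
# `ω × U` — is co-band-limited modulo a gradient is trivial; in particular no Beltrami-type
# profile (route `AngularGalerkinLadder`, crux K1 `RungBlowupCofinal`; helper, theorems only)

Cell `ns-blowup`, seat `ns-blowup-circuit` (g12, AGL Lean seat). Helper file for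
`stmt-NavierStokesRegularity-19959` (K1 of route №8), in SIMILARITY variables — a corollary of
`PureWaveExclusion.eq_zero_of_linearProfile` that needs no passage to physical variables: the
steady/precessing twin of `NonlinearityLoadBearing.lean`.

## Statements (letters of the line's `Qlwave.IsPrecessingRungProfile L α C U Q E` unfolded:
`U` band-limited divergence free, `Q` smooth, `E` CONTINUOUS co-band-limited, residual
`−ΔU + ½U + ½DU·y + αJ₃U + (U·∇)U + ∇Q − E = 0`, Type-I tail `‖U(y)‖ ≤ C/(‖y‖ + 1)`)

* `eq_zero_of_convect_coband`: if moreover `(U·∇)U + ∇q` is co-band-limited for some smooth `q`,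
  then `U = 0` — moving the invisible nonlinearity into the defect and the gradient into the
  pressure leaves the LINEAR equation of `PureWaveExclusion`.
* `eq_zero_of_lamb_coband`: the same with the Lamb vector: if `(curl U) × U + ∇q` is co-band for a
  smooth `q`, then `U = 0` (`(U·∇)U = ω × U + ∇(½|U|²)`, tree `convect_self_eq_cross_curl_add_gradient`).
* `eq_zero_of_lamb_eq_gradient` / `eq_zero_of_beltrami`: in particular a precessing rung profile
  with `ω × U = ∇q` (generalised Beltrami), or with `ω × U ≡ 0` (Beltrami / force-free, e.g.
  `curl U = λU`), is trivial — at every rung and every precession rate.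

Reading for the line's ideation: any candidate for stub 3/4 must have a Lamb vector with a
NON-GRADIENT BAND PART; ABC/Beltrami-type and potential-flow-type ansätze are dead on arrival.

LABEL: KERNEL (MODEL `NS_L`'s profile system). Nothing here asserts a Theses declaration; no
definition, no named fact, no sorry. WHAT THIS IS NOT: not Navier–Stokes evidence; no profile is
constructed. References: [cite: KochNadirashviliSereginSverak2009, Lemma 3.1 (arXiv:0709.3599v1
p. 7)]; [cite: MajdaBertozziCUP2002, §2.1 (Lamb form)]; [cite: BullardGellman1954].
-/

noncomputable section

namespace Summit.NavierStokesRegularity.AngularGalerkinLadderPrecessingProfileLambLoadBearing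

open Set Function InnerProductSpace
open scoped RealInnerProductSpace Laplacian ContDiff
open Literature.Analysis.FluidPDE
open Summit.NavierStokesRegularity.FluidComputer
open Summit.NavierStokesRegularity.FluidComputer.AngularLadder
open Summit.NavierStokesRegularity.AngularGalerkinLadderPureWaveExclusion

variable {L : ℕ} {α C : ℝ}
  {U E : EuclideanSpace ℝ (Fin 3) → EuclideanSpace ℝ (Fin 3)} {Q : EuclideanSpace ℝ (Fin 3) → ℝ}

/-- The gradient of a scalar with smooth derivative field is smooth. [folklore] -/
private theorem contDiff_gradient_of_smooth {q : EuclideanSpace ℝ (Fin 3) → ℝ} (hq : ContDiff ℝ ∞ q) :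
    ContDiff ℝ ∞ (gradient q) := by
  have e : gradient q = fun y =>
      (InnerProductSpace.toDual ℝ (EuclideanSpace ℝ (Fin 3))).symm (fderiv ℝ q y) := rfl
  rw [e]
  exact (InnerProductSpace.toDual ℝ (EuclideanSpace ℝ (Fin 3))).symm.contDiff.comp
    ((contDiff_infty_iff_fderiv.1 hq).2)

/-- The gradient of a difference of differentiable functions. [folklore] -/
private theorem gradient_sub' {g g' : EuclideanSpace ℝ (Fin 3) → ℝ} {x : EuclideanSpace ℝ (Fin 3)}
    (hg : DifferentiableAt ℝ g x) (hg' : DifferentiableAt ℝ g' x) :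
    gradient (fun y => g y - g' y) x = gradient g x - gradient g' x := by
  simp only [gradient, fderiv_fun_sub hg hg', map_sub]

/-- **A precessing rung profile whose self-advection is co-band modulo a gradient is trivial.**
In the letters of `IsPrecessingRungProfile L α C U Q E` (continuous co-band defect `E`, residual
`−ΔU + ½U + ½DU·y + αJ₃U + (U·∇)U + ∇Q − E = 0`, Type-I tail): if `(U·∇)U + ∇q` is
co-band-limited for a smooth `q`, then `U = 0` — the remaining equation
`−ΔU + ½U + ½DU·y + αJ₃U + ∇(Q − q) = E − ((U·∇)U + ∇q)` is the LINEAR one of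
`PureWaveExclusion.eq_zero_of_linearProfile` with a co-band right-hand side.
[cite: KochNadirashviliSereginSverak2009, Lemma 3.1 (arXiv:0709.3599v1 p. 7)] -/
theorem eq_zero_of_convect_coband (hU : IsBandLimited L U) (hdiv : VectorCalculus.IsDivFree U)
    (hQ : ContDiff ℝ ∞ Q) (hEc : Continuous E) (hE : IsCobandLimited L E)
    (hres : ∀ y, -(Δ U) y + (1 / 2 : ℝ) • U y + (1 / 2 : ℝ) • fderiv ℝ U y y + α • angGen 2 U y +
      convect U U y + gradient Q y - E y = 0)
    (hdec : ∀ y, ‖U y‖ ≤ C / (‖y‖ + 1))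
    {q : EuclideanSpace ℝ (Fin 3) → ℝ} (hq : ContDiff ℝ ∞ q)
    (hX : IsCobandLimited L fun y => convect U U y + gradient q y) : U = 0 := by
  have hUs : ContDiff ℝ ∞ U := hU.1
  -- the invisible nonlinearity `X = (U·∇)U + ∇q` is smooth, hence continuous
  have hXc : Continuous (fun y => convect U U y + gradient q y) := by
    have hconv : ContDiff ℝ ∞ (fun y => convect U U y) := by
      have e : (fun y => convect U U y) = fun y => fderiv ℝ U y (U y) := rfl
      rw [e]
      exact ((contDiff_infty_iff_fderiv.1 hUs).2).clm_apply hUs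
    exact (hconv.add (contDiff_gradient_of_smooth hq)).continuous
  -- the new defect `E' = E − X` is co-band
  have hE' : IsCobandLimited L (E + -(fun y => convect U U y + gradient q y)) :=
    hE.add hX.neg hEc hXc.neg
  refine eq_zero_of_linearProfile (α := α) (C := C) (Q := fun y => Q y - q y) hU hdiv (hQ.sub hq)
    hE' (fun y => ?_) hdec
  have hQd : DifferentiableAt ℝ Q y := (hQ.differentiable (by simp)) y
  have hqd : DifferentiableAt ℝ q y := (hq.differentiable (by simp)) y
  rw [gradient_sub' hQd hqd]
  have h := hres y
  simp only [Pi.add_apply, Pi.neg_apply]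
  rw [← sub_eq_zero]
  rw [← sub_eq_zero] at h
  rw [← h]
  abel

/-- **The band part of the LAMB VECTOR is load-bearing.** Same hypotheses; if the Lamb vector
modulo a gradient, `(curl U) × U + ∇q`, is co-band-limited for a smooth `q`, then `U = 0` —
since `(U·∇)U = (curl U) × U + ∇(½|U|²)`. [cite: MajdaBertozziCUP2002, §2.1 (Lamb form)] -/
theorem eq_zero_of_lamb_coband (hU : IsBandLimited L U) (hdiv : VectorCalculus.IsDivFree U)
    (hQ : ContDiff ℝ ∞ Q) (hEc : Continuous E) (hE : IsCobandLimited L E)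
    (hres : ∀ y, -(Δ U) y + (1 / 2 : ℝ) • U y + (1 / 2 : ℝ) • fderiv ℝ U y y + α • angGen 2 U y +
      convect U U y + gradient Q y - E y = 0)
    (hdec : ∀ y, ‖U y‖ ≤ C / (‖y‖ + 1))
    {q : EuclideanSpace ℝ (Fin 3) → ℝ} (hq : ContDiff ℝ ∞ q)
    (hΛ : IsCobandLimited L fun y => cross (curl U y) (U y) + gradient q y) : U = 0 := by
  have hUs : ContDiff ℝ ∞ U := hU.1
  have hUd : Differentiable ℝ U := hUs.differentiable (by simp)
  have hkin : ContDiff ℝ ∞ (fun y => ‖U y‖ ^ 2 / 2) := (hUs.norm_sq ℝ).div_const 2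
  -- `(U·∇)U + ∇(q − ½|U|²) = ω × U + ∇q`
  refine eq_zero_of_convect_coband hU hdiv hQ hEc hE hres hdec (hq.sub hkin) ?_
  have e : (fun y => convect U U y + gradient (fun z => q z - ‖U z‖ ^ 2 / 2) y) =
      fun y => cross (curl U y) (U y) + gradient q y := by
    funext y
    have hqd : DifferentiableAt ℝ q y := (hq.differentiable (by simp)) y
    have hkd : DifferentiableAt ℝ (fun z => ‖U z‖ ^ 2 / 2) y := (hkin.differentiable (by simp)) y
    rw [convect_self_eq_cross_curl_add_gradient (hUd y), gradient_sub' hqd hkd]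
    abel
  rw [e]
  exact hΛ

/-- **Generalised-Beltrami precessing rung profiles are trivial**: if the Lamb vector is an exact
smooth gradient, `(curl U) × U = ∇q`, then `U = 0`. [folklore] -/
theorem eq_zero_of_lamb_eq_gradient (hU : IsBandLimited L U) (hdiv : VectorCalculus.IsDivFree U)
    (hQ : ContDiff ℝ ∞ Q) (hEc : Continuous E) (hE : IsCobandLimited L E)
    (hres : ∀ y, -(Δ U) y + (1 / 2 : ℝ) • U y + (1 / 2 : ℝ) • fderiv ℝ U y y + α • angGen 2 U y +
      convect U U y + gradient Q y - E y = 0)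
    (hdec : ∀ y, ‖U y‖ ≤ C / (‖y‖ + 1))
    {q : EuclideanSpace ℝ (Fin 3) → ℝ} (hq : ContDiff ℝ ∞ q)
    (hΛ : ∀ y, cross (curl U y) (U y) = gradient q y) : U = 0 := by
  refine eq_zero_of_lamb_coband hU hdiv hQ hEc hE hres hdec hq.neg ?_
  have e : (fun y => cross (curl U y) (U y) + gradient (fun z => -q z) y) = 0 := by
    funext y
    have : gradient (fun z => -q z) y = -gradient q y := by
      simp only [gradient, fderiv_fun_neg, map_neg]
    rw [this, hΛ y]
    simp
  rw [e]
  exact isCobandLimited_zero_field L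

/-- **Beltrami (force-free) precessing rung profiles are trivial**: if `(curl U) × U ≡ 0` (e.g.
`curl U = λ U`), then `U = 0` — at every rung `L` and every precession rate `α`. [folklore] -/
theorem eq_zero_of_beltrami (hU : IsBandLimited L U) (hdiv : VectorCalculus.IsDivFree U)
    (hQ : ContDiff ℝ ∞ Q) (hEc : Continuous E) (hE : IsCobandLimited L E)
    (hres : ∀ y, -(Δ U) y + (1 / 2 : ℝ) • U y + (1 / 2 : ℝ) • fderiv ℝ U y y + α • angGen 2 U y +
      convect U U y + gradient Q y - E y = 0)
    (hdec : ∀ y, ‖U y‖ ≤ C / (‖y‖ + 1))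
    (hΛ : ∀ y, cross (curl U y) (U y) = 0) : U = 0 := by
  refine eq_zero_of_lamb_eq_gradient hU hdiv hQ hEc hE hres hdec (q := fun _ => 0)
    contDiff_const fun y => ?_
  rw [hΛ y]
  simp [gradient]

/-- **Eigenfields of the curl are trivial as precessing rung profiles**: `curl U = λ U` pointwise
forces `U = 0` under the hypotheses above (`(λU) × U = 0`). [folklore] -/
theorem eq_zero_of_curl_eq_smul (hU : IsBandLimited L U) (hdiv : VectorCalculus.IsDivFree U)
    (hQ : ContDiff ℝ ∞ Q) (hEc : Continuous E) (hE : IsCobandLimited L E)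
    (hres : ∀ y, -(Δ U) y + (1 / 2 : ℝ) • U y + (1 / 2 : ℝ) • fderiv ℝ U y y + α • angGen 2 U y +
      convect U U y + gradient Q y - E y = 0)
    (hdec : ∀ y, ‖U y‖ ≤ C / (‖y‖ + 1)) {lam : ℝ} (hcurl : ∀ y, curl U y = lam • U y) : U = 0 := by
  refine eq_zero_of_beltrami hU hdiv hQ hEc hE hres hdec fun y => ?_
  rw [hcurl y]
  apply PiLp.ext
  intro i
  fin_cases i <;> simp [cross]

end Summit.NavierStokesRegularity.AngularGalerkinLadderPrecessingProfileLambLoadBearing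

end
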